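import Summits.QuantumFields.YangMills.Theorems.Instrument.AbstractPolymerKraft
import HarnessLib

/-!
# Instrument cell `ym-instrument`, crew (b): the Kraft tail bound `≤ (7/10)·(299/20)^n` for an ABSTRACT plaquette–link incidence system (part 2: the run of an admissible complex
# and the count; part 1 = `AbstractPolymerKraft`)

QUESTIONS.md: Q-B2 (S2-SPEC v0.5.1 §0 reading (β-torus): the (G1) remainder's T2′ tail on the finite torus, RADIUS-DERIVATION v0.6.2 (7.0) consequence (b) «holds there by the local
encoding» — here typed for ANY finite incidence system); cell `run/shared/lean/pub/ym-instrument/`, HUMAN RULING D-0084 (2), director-ym R138.  HONEST FRAMING (page 1, binding).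
WHAT IS CERTIFIED HERE: PURE COMBINATORICS of a finite abstract incidence system `𝓘` (`AbstractPolymerKraft.IncidenceSystem`: `#edges p ≤ 4`, `#{p : e ∈ edges p} ≤ 6`): for every
link predicate `Adm` and every admissible root `e`, the number of `n`-element plaquette sets `X` with `e ∈ links X`, connected through shared admissible links (`IsAdmConnected`) and
with every admissible link of `X` in `≥ 2` members (`AdmClosed`), is `≤ (7/10)·((100/19)(119/100)^6)^n ≤ (7/10)·(299/20)^n` (`admClosedCount_le_T2`) — the landed `ℤ⁴` proof
(`ClosedComplexTailBound`) VERBATIM: invariant `Inv`, potentials `Φ/U/μ`, `wt_lower`, `W_lower`, valid family inside `Finset.univ`.  Instances: every torus `(ℤ/L)⁴`, `L ≥ 3`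
(separate file).  NOT a statement about any gauge theory, NOT a radius, NOT summit-bearing.  Grade (T).
-/

noncomputable section

open Finset

namespace Summit.QuantumFields.YangMills.Theorems.Instrument.AbstractPolymerTailBound

open Summit.QuantumFields.YangMills.Theorems.Instrument.AbstractPolymerKraft

variable {P E : Type*} [Fintype P] [DecidableEq P] [DecidableEq E] [Inhabited E] (𝓘 : IncidenceSystem P E)
variable (Adm : E → Prop) [DecidablePred Adm]

/-! ## §3 The lower bound along the run of an admissible complex (verbatim from `ClosedComplexTailBound`) -/

/-- The invariant of the exploration of `X` from the root link `e`. [folklore] -/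
structure Inv (e : E) (X : Finset P) (s : State P E) : Prop where
  /-- born plaquettes belong to the target -/
  sub : s.Y ⊆ X
  /-- decided links are saturated -/
  sat : ∀ l ∈ s.D, atLink 𝓘 X l ⊆ s.Y
  /-- the root link is decided -/
  root : e ∈ s.D

/-- The potential: undecided (plaquette, link) incidences of the target. [folklore] -/
def Φ (X : Finset P) (s : State P E) : ℕ := ∑ p ∈ X, (𝓘.edges p \ s.D).card

/-- The unborn plaquettes of the target. [folklore] -/
def U (X : Finset P) (s : State P E) : ℕ := (X \ s.Y).card

/-- The termination measure: undecided admissible links of the target. [folklore] -/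
def μ (X : Finset P) (s : State P E) : ℕ := ((links 𝓘 X).filter Adm \ s.D).card

omit [DecidableEq P] [Inhabited E] in
/-- Links of a subfamily are links of the family. [folklore] -/
theorem links_mono {Y X : Finset P} (h : Y ⊆ X) : links 𝓘 Y ⊆ links 𝓘 X := biUnion_subset_biUnion_of_subset_left _ h

omit [DecidableEq P] [Inhabited E] in
/-- Completeness: at a terminal state everything is born. [folklore] -/
theorem eq_of_terminal {e : E} {X : Finset P} {s : State P E} (hI : Inv 𝓘 e X s) (hconn : IsAdmConnected 𝓘 Adm X) (hroot : e ∈ links 𝓘 X)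
    (h : und 𝓘 Adm s = ∅) : s.Y = X := by
  have hD : (links 𝓘 s.Y).filter Adm ⊆ s.D := by
    have := h; unfold und at this
    exact sdiff_eq_empty_iff_subset.1 this
  obtain ⟨p₀, hp₀X, hp₀e⟩ := mem_biUnion.1 hroot
  have hp₀ : p₀ ∈ s.Y := hI.sat _ hI.root (mem_filter.2 ⟨hp₀X, hp₀e⟩)
  refine Subset.antisymm hI.sub fun q hq => ?_
  have hpath := hconn p₀ hp₀X q hq
  clear hq
  induction hpath with
  | refl => exact hp₀
  | @tail b c _ hbc ih =>
    obtain ⟨-, hc, l, hl, hlb, hlc⟩ := hbc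
    have hlD : l ∈ s.D := hD (mem_filter.2 ⟨mem_biUnion.2 ⟨b, ih, hlb⟩, hl⟩)
    exact hI.sat l hlD (mem_filter.2 ⟨hc, hlc⟩)

/-- The invariant is preserved by a block. [folklore] -/
theorem inv_step {e : E} {X : Finset P} {s : State P E} (hI : Inv 𝓘 e X s) : Inv 𝓘 e X (step 𝓘 Adm s X) := by
  refine ⟨?_, ?_, ?_⟩
  · intro p hp
    rcases mem_union.1 hp with hp | hp
    · exact hI.sub hp
    · exact (mem_sdiff.1 (mem_filter.1 hp).1).1
  · intro l hl p hp
    change p ∈ s.Y ∪ atLink 𝓘 (X \ s.Y) (sel (und 𝓘 Adm s))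
    rcases mem_insert.1 hl with rfl | hl
    · by_cases hpY : p ∈ s.Y
      · exact mem_union_left _ hpY
      · exact mem_union_right _ (mem_filter.2 ⟨mem_sdiff.2 ⟨(mem_filter.1 hp).1, hpY⟩, (mem_filter.1 hp).2⟩)
    · exact mem_union_left _ (hI.sat l hl hp)
  · exact mem_insert_of_mem hI.root

omit [DecidableEq P] in
/-- At a non-terminal state the selected link is an undecided admissible link of the target. [folklore] -/
theorem sel_mem_sdiff {e : E} {X : Finset P} {s : State P E} (hI : Inv 𝓘 e X s) (h : und 𝓘 Adm s ≠ ∅) :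
    sel (und 𝓘 Adm s) ∈ (links 𝓘 X).filter Adm \ s.D := by
  have hne : (und 𝓘 Adm s).Nonempty := nonempty_iff_ne_empty.2 h
  have hmem := sel_mem hne
  unfold und at hmem
  obtain ⟨h1, h2⟩ := mem_sdiff.1 hmem
  exact mem_sdiff.2 ⟨filter_subset_filter _ (links_mono 𝓘 hI.sub) h1, h2⟩

/-- The termination measure drops by one at each block. [folklore] -/
theorem μ_step {e : E} {X : Finset P} {s : State P E} (hI : Inv 𝓘 e X s) (h : und 𝓘 Adm s ≠ ∅) :
    μ 𝓘 Adm X (step 𝓘 Adm s X) + 1 = μ 𝓘 Adm X s := by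
  unfold μ step
  rw [sdiff_insert, card_erase_add_one (sel_mem_sdiff 𝓘 Adm hI h)]

/-- Unborn plaquettes telescope. [folklore] -/
theorem U_step {X : Finset P} {s : State P E} : U X s = (atLink 𝓘 (X \ s.Y) (sel (und 𝓘 Adm s))).card + U X (step 𝓘 Adm s X) := by
  unfold U step
  change (X \ s.Y).card = _ + (X \ (s.Y ∪ atLink 𝓘 (X \ s.Y) (sel (und 𝓘 Adm s)))).card
  have hsub : atLink 𝓘 (X \ s.Y) (sel (und 𝓘 Adm s)) ⊆ X \ s.Y := filter_subset _ _
  rw [show X \ (s.Y ∪ atLink 𝓘 (X \ s.Y) (sel (und 𝓘 Adm s))) = (X \ s.Y) \ atLink 𝓘 (X \ s.Y) (sel (und 𝓘 Adm s)) from sdiff_sdiff_left.symm,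
    card_sdiff_of_subset hsub]
  have : (atLink 𝓘 (X \ s.Y) (sel (und 𝓘 Adm s))).card ≤ (X \ s.Y).card := card_le_card hsub
  omega

/-- The potential drops at a block by the degree of the decided link in the target. [folklore] -/
theorem Φ_step {e : E} {X : Finset P} {s : State P E} (hI : Inv 𝓘 e X s) (h : und 𝓘 Adm s ≠ ∅) :
    Φ 𝓘 X s = (atLink 𝓘 X (sel (und 𝓘 Adm s))).card + Φ 𝓘 X (step 𝓘 Adm s X) := by
  have hl : sel (und 𝓘 Adm s) ∉ s.D := (mem_sdiff.1 (sel_mem_sdiff 𝓘 Adm hI h)).2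
  unfold Φ step
  change _ = _ + ∑ p ∈ X, (𝓘.edges p \ insert (sel (und 𝓘 Adm s)) s.D).card
  rw [card_filter, ← sum_add_distrib]
  refine sum_congr rfl fun p _ => ?_
  rw [sdiff_insert]
  by_cases hp : sel (und 𝓘 Adm s) ∈ 𝓘.edges p
  · rw [if_pos hp, ← card_erase_add_one (mem_sdiff.2 ⟨hp, hl⟩)]; ring
  · rw [if_neg hp, erase_eq_of_notMem (fun hm => hp (mem_sdiff.1 hm).1)]; ring

omit [Inhabited E] in
/-- The degree of a link in the target splits into born and new-born plaquettes. [folklore] -/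
theorem card_atLink_split {e : E} {X : Finset P} {s : State P E} (hI : Inv 𝓘 e X s) (l : E) :
    (atLink 𝓘 X l).card = (atLink 𝓘 s.Y l).card + (atLink 𝓘 (X \ s.Y) l).card := by
  rw [← card_union_of_disjoint (disjoint_filter_filter disjoint_sdiff)]
  congr 1
  rw [← filter_union, union_sdiff_of_subset hI.sub]

/-- Lower bound along the run: `x^U · y^Φ ≤ wt · y^U`. [folklore] -/
theorem wt_lower {e : E} {X : Finset P} (hclosed : AdmClosed 𝓘 Adm X) (hconn : IsAdmConnected 𝓘 Adm X) (hroot : e ∈ links 𝓘 X) :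
    ∀ (k : ℕ) (s : State P E), Inv 𝓘 e X s → μ 𝓘 Adm X s ≤ k → xK ^ U X s * yK ^ Φ 𝓘 X s ≤ wt 𝓘 Adm k s X * yK ^ U X s := by
  have hterm : ∀ (k : ℕ) (s : State P E), Inv 𝓘 e X s → und 𝓘 Adm s = ∅ → xK ^ U X s * yK ^ Φ 𝓘 X s ≤ wt 𝓘 Adm k s X * yK ^ U X s := by
    intro k s hI h
    have hYX : s.Y = X := eq_of_terminal 𝓘 Adm hI hconn hroot h
    have hU : U X s = 0 := by unfold U; rw [hYX, Finset.sdiff_self, card_empty]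
    rw [wt_terminal 𝓘 Adm h, if_pos hYX, hU, pow_zero, pow_zero, one_mul, one_mul]
    exact pow_le_one₀ yK_pos.le yK_le_one
  intro k
  induction k with
  | zero =>
    intro s hI hμ
    by_cases h : und 𝓘 Adm s = ∅
    · exact hterm 0 s hI h
    · exfalso
      have : 0 < μ 𝓘 Adm X s := card_pos.2 ⟨_, sel_mem_sdiff 𝓘 Adm hI h⟩
      omega
  | succ k ih =>
    intro s hI hμ
    by_cases h : und 𝓘 Adm s = ∅
    · exact hterm (k + 1) s hI h
    · have hμ' : μ 𝓘 Adm X (step 𝓘 Adm s X) ≤ k := by have := μ_step 𝓘 Adm hI h; omega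
      have hI' := inv_step 𝓘 Adm hI (X := X)
      have hrec := ih (step 𝓘 Adm s X) hI' hμ'
      set l := sel (und 𝓘 Adm s) with hl
      set c := (atLink 𝓘 s.Y l).card with hc
      set m := (atLink 𝓘 (X \ s.Y) l).card with hm
      have hdeg : 2 ≤ c + m := by
        rw [hc, hm, ← card_atLink_split 𝓘 hI l]
        have hsel := mem_sdiff.1 (sel_mem_sdiff 𝓘 Adm hI h)
        exact hclosed l (mem_filter.1 hsel.1).1 (mem_filter.1 hsel.1).2
      have hbw : bw c m = xK ^ m * yK ^ c := by unfold bw; rw [if_pos hdeg]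
      have hU : U X s = m + U X (step 𝓘 Adm s X) := U_step 𝓘 Adm
      have hΦ : Φ 𝓘 X s = (c + m) + Φ 𝓘 X (step 𝓘 Adm s X) := by rw [Φ_step 𝓘 Adm hI h, card_atLink_split 𝓘 hI l]
      rw [wt_succ 𝓘 Adm h, ← hl, ← hc, ← hm, hbw, hU, hΦ]
      have hx := xK_pos
      have hy := yK_pos
      calc xK ^ (m + U X (step 𝓘 Adm s X)) * yK ^ (c + m + Φ 𝓘 X (step 𝓘 Adm s X))
          = (xK ^ m * yK ^ c * yK ^ m) * (xK ^ U X (step 𝓘 Adm s X) * yK ^ Φ 𝓘 X (step 𝓘 Adm s X)) := by ring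
        _ ≤ (xK ^ m * yK ^ c * yK ^ m) * (wt 𝓘 Adm k (step 𝓘 Adm s X) X * yK ^ U X (step 𝓘 Adm s X)) :=
            mul_le_mul_of_nonneg_left hrec (by positivity)
        _ = xK ^ m * yK ^ c * wt 𝓘 Adm k (step 𝓘 Adm s X) X * yK ^ (m + U X (step 𝓘 Adm s X)) := by ring

omit [DecidableEq P] [Inhabited E] in
/-- The initial state satisfies the invariant. [folklore] -/
theorem inv_init (e : E) (X : Finset P) : Inv 𝓘 e X (init 𝓘 e X) :=
  ⟨filter_subset _ _, fun l hl => by rw [mem_singleton.1 hl]; exact Subset.rfl, mem_singleton_self _⟩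

omit [DecidableEq P] [Inhabited E] in
/-- At most four links per plaquette, summed. [folklore] -/
theorem card_links_le (X : Finset P) : (links 𝓘 X).card ≤ 4 * X.card := by
  unfold links
  refine card_biUnion_le.trans ?_
  calc ∑ p ∈ X, (𝓘.edges p).card ≤ ∑ _p ∈ X, 4 := sum_le_sum fun p _ => 𝓘.card_edges_le p
    _ = 4 * X.card := by rw [sum_const, smul_eq_mul, mul_comm]

omit [DecidableEq P] [Inhabited E] in
/-- The initial potential: `Φ(init e X) + m₀ ≤ 4n`. [folklore] -/
theorem Φ_init_le (e : E) (X : Finset P) : Φ 𝓘 X (init 𝓘 e X) + (atLink 𝓘 X e).card ≤ 4 * X.card := by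
  unfold Φ init
  change ∑ p ∈ X, (𝓘.edges p \ {e}).card + (X.filter fun p => e ∈ 𝓘.edges p).card ≤ _
  rw [card_filter, ← sum_add_distrib]
  calc ∑ p ∈ X, ((𝓘.edges p \ {e}).card + if e ∈ 𝓘.edges p then 1 else 0)
      = ∑ p ∈ X, (𝓘.edges p).card := by
        refine sum_congr rfl fun p _ => ?_
        rw [sdiff_singleton_eq_erase]
        by_cases hp : e ∈ 𝓘.edges p
        · rw [if_pos hp, card_erase_add_one hp]
        · rw [if_neg hp, erase_eq_of_notMem hp, add_zero]
    _ ≤ ∑ _p ∈ X, 4 := sum_le_sum fun p _ => 𝓘.card_edges_le p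
    _ = 4 * X.card := by rw [sum_const, smul_eq_mul, mul_comm]

/-- The weight of an admissible `n`-complex through the admissible root link is at least `x^n y^{3n}`. [folklore] -/
theorem W_lower {e : E} (he : Adm e) {n : ℕ} {X : Finset P} (hcard : X.card = n) (hroot : e ∈ links 𝓘 X)
    (hconn : IsAdmConnected 𝓘 Adm X) (hclosed : AdmClosed 𝓘 Adm X) : xK ^ n * yK ^ (3 * n) ≤ W 𝓘 Adm e n X := by
  have hx := xK_pos
  have hy := yK_pos
  set m₀ := (atLink 𝓘 X e).card with hm₀
  have hm₀n : m₀ ≤ n := hcard ▸ card_le_card (filter_subset _ _)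
  have hdeg : 2 ≤ 0 + m₀ := by rw [zero_add]; exact hclosed _ hroot he
  have hbw : bw 0 m₀ = xK ^ m₀ := by unfold bw; rw [if_pos hdeg, pow_zero, mul_one]
  have hU : U X (init 𝓘 e X) = n - m₀ := by
    unfold U init
    rw [card_sdiff_of_subset (filter_subset _ _), hcard]
  have hμ : μ 𝓘 Adm X (init 𝓘 e X) ≤ 4 * n := by
    have h4 : (links 𝓘 X).card ≤ 4 * n := by rw [← hcard]; exact card_links_le 𝓘 X
    unfold μ
    exact (card_le_card sdiff_subset).trans ((card_le_card (filter_subset _ _)).trans h4)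
  have hΦ : Φ 𝓘 X (init 𝓘 e X) ≤ 3 * n + (n - m₀) := by
    have := Φ_init_le 𝓘 e X
    rw [hcard, ← hm₀] at this
    omega
  have hrun := wt_lower 𝓘 Adm hclosed hconn hroot (4 * n) (init 𝓘 e X) (inv_init 𝓘 e X) hμ
  rw [hU] at hrun
  have h1 : xK ^ (n - m₀) * yK ^ (3 * n + (n - m₀)) ≤ wt 𝓘 Adm (4 * n) (init 𝓘 e X) X * yK ^ (n - m₀) :=
    (mul_le_mul_of_nonneg_left (pow_le_pow_of_le_one hy.le yK_le_one hΦ) (by positivity)).trans hrun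
  have h2 : (xK ^ n * yK ^ (3 * n)) * yK ^ (n - m₀) ≤ W 𝓘 Adm e n X * yK ^ (n - m₀) := by
    unfold W
    rw [← hm₀, hbw]
    calc (xK ^ n * yK ^ (3 * n)) * yK ^ (n - m₀) = xK ^ m₀ * (xK ^ (n - m₀) * yK ^ (3 * n + (n - m₀))) := by
          have hxn : xK ^ n = xK ^ m₀ * xK ^ (n - m₀) := by rw [← pow_add, Nat.add_sub_cancel' hm₀n]
          rw [hxn, pow_add]; ring
      _ ≤ xK ^ m₀ * (wt 𝓘 Adm (4 * n) (init 𝓘 e X) X * yK ^ (n - m₀)) := mul_le_mul_of_nonneg_left h1 (by positivity)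
      _ = xK ^ m₀ * wt 𝓘 Adm (4 * n) (init 𝓘 e X) X * yK ^ (n - m₀) := by ring
  exact le_of_mul_le_mul_right h2 (by positivity)

/-! ## §4 ★ The tail bound for every finite incidence system, every admissibility class -/

open Classical in
/-- The finite family of admissible `n`-complexes through `e` (inside `Finset.univ`, `P` finite). [folklore] -/
def validFamily (e : E) (n : ℕ) : Finset (Finset P) :=
  Finset.univ.filter fun X => X.card = n ∧ e ∈ links 𝓘 X ∧ IsAdmConnected 𝓘 Adm X ∧ AdmClosed 𝓘 Adm X

omit [DecidablePred Adm] [Inhabited E] [DecidableEq P] in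
open Classical in
/-- Membership in the valid family is validity. [folklore] -/
theorem mem_validFamily {e : E} {n : ℕ} {X : Finset P} :
    X ∈ validFamily 𝓘 Adm e n ↔ X.card = n ∧ e ∈ links 𝓘 X ∧ IsAdmConnected 𝓘 Adm X ∧ AdmClosed 𝓘 Adm X := by
  unfold validFamily
  rw [mem_filter]
  exact ⟨fun h => h.2, fun h => ⟨mem_univ _, h⟩⟩

omit [DecidablePred Adm] [Inhabited E] [DecidableEq P] in
/-- The count is the cardinality of the valid family. [folklore] -/
theorem admClosedCount_eq_card (e : E) (n : ℕ) :
    Nat.card {X : Finset P // X.card = n ∧ e ∈ links 𝓘 X ∧ IsAdmConnected 𝓘 Adm X ∧ AdmClosed 𝓘 Adm X} = (validFamily 𝓘 Adm e n).card := by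
  have hset : {X : Finset P | X.card = n ∧ e ∈ links 𝓘 X ∧ IsAdmConnected 𝓘 Adm X ∧ AdmClosed 𝓘 Adm X} = (↑(validFamily 𝓘 Adm e n) : Set (Finset P)) := by
    ext X
    rw [Set.mem_setOf_eq, mem_coe, mem_validFamily]
  calc Nat.card {X : Finset P // X.card = n ∧ e ∈ links 𝓘 X ∧ IsAdmConnected 𝓘 Adm X ∧ AdmClosed 𝓘 Adm X}
      = ({X : Finset P | X.card = n ∧ e ∈ links 𝓘 X ∧ IsAdmConnected 𝓘 Adm X ∧ AdmClosed 𝓘 Adm X}).ncard := Nat.card_coe_set_eq _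
    _ = (↑(validFamily 𝓘 Adm e n) : Set (Finset P)).ncard := by rw [hset]
    _ = (validFamily 𝓘 Adm e n).card := Set.ncard_coe_finset _

/-- ★ `count · x^n y^{3n} ≤ 7/10` through an admissible root. [folklore] -/
theorem admClosedCount_mul_le {e : E} (he : Adm e) (n : ℕ) :
    (Nat.card {X : Finset P // X.card = n ∧ e ∈ links 𝓘 X ∧ IsAdmConnected 𝓘 Adm X ∧ AdmClosed 𝓘 Adm X} : ℝ) * (xK ^ n * yK ^ (3 * n)) ≤ 7 / 10 := by
  rw [admClosedCount_eq_card, ← nsmul_eq_mul, ← sum_const]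
  refine (sum_le_sum fun X hX => ?_).trans (kraft_root_sum 𝓘 Adm e n (validFamily 𝓘 Adm e n))
  obtain ⟨hcard, hroot, hconn, hclosed⟩ := (mem_validFamily 𝓘 Adm).1 hX
  exact W_lower 𝓘 Adm he hcard hroot hconn hclosed

/-- ★ **T2′ for every finite incidence system and every admissibility class**: `≤ (7/10)·((100/19)·(119/100)^6)^n`. [folklore] -/
theorem admClosedCount_le_kraft {e : E} (he : Adm e) (n : ℕ) :
    (Nat.card {X : Finset P // X.card = n ∧ e ∈ links 𝓘 X ∧ IsAdmConnected 𝓘 Adm X ∧ AdmClosed 𝓘 Adm X} : ℝ) ≤ 7 / 10 * ((100 / 19) * (119 / 100 : ℝ) ^ 6) ^ n := by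
  have h := admClosedCount_mul_le 𝓘 Adm he n
  have hxy : xK ^ n * yK ^ (3 * n) = (((100 / 19) * (119 / 100 : ℝ) ^ 6) ^ n)⁻¹ := by
    rw [pow_mul, ← mul_pow, ← inv_pow]
    congr 1
    unfold xK yK; norm_num
  rw [hxy] at h
  have hpos : 0 < ((100 / 19) * (119 / 100 : ℝ) ^ 6) ^ n := by positivity
  rwa [← div_eq_mul_inv, div_le_iff₀ hpos] at h

/-- ★ **T2′, printed constant**: `≤ (7/10)·(299/20)^n = 0.7·14.95ⁿ`. [folklore] -/
theorem admClosedCount_le_T2 {e : E} (he : Adm e) (n : ℕ) :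
    (Nat.card {X : Finset P // X.card = n ∧ e ∈ links 𝓘 X ∧ IsAdmConnected 𝓘 Adm X ∧ AdmClosed 𝓘 Adm X} : ℝ) ≤ 7 / 10 * (299 / 20 : ℝ) ^ n :=
  (admClosedCount_le_kraft 𝓘 Adm he n).trans (mul_le_mul_of_nonneg_left (pow_le_pow_left₀ (by positivity) (by norm_num) n) (by norm_num))

end Summit.QuantumFields.YangMills.Theorems.Instrument.AbstractPolymerTailBound

end
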